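import Literature.Probability.RandomPlanarGeometry.HexSAWPolygonMadrasExponent
import Literature.Probability.RandomPlanarGeometry.HexSAWPolygonSupermult
import HarnessLib

/-!
# Madras' bound on the honeycomb lattice with an EXPLICIT constant: `q_N(ℍ) ≤ 10⁶ · N^{−1/2} · √(2+√2)^N`

Topic `Literature/Probability/RandomPlanarGeometry` (lane «pcv-sawmu», a-p4 g15; sequel of LINE «HEX-MADRAS», whose last module
`HexSAWPolygonMadrasExponent.lean` proves `HexBW.hexPolygonNumber_le_rpow_half : ∃ A, ∀ N ≥ 1, q_N(ℍ) ≤ A·N^{−1/2}·√(2+√2)^N` —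
Madras' `θ ≥ 1/2` on `ℍ` — with an unspecified constant `A`, because the tree's doubling bootstrap
`HexSAWPolygonMadrasBootstrapPair.rpow_bound_of_joinIneq_abstract` bounds the small lengths by a sum of actual polygon counts).

Here the constant is made explicit, exactly as the lane did on `ℤ²` (`SAWPolygonMadrasBound.lean`:
`SAW.JoinParity.madras1995_polygonBound_explicit`, `A = 2μ¹⁶`).  Three inputs, all tree theorems: (i) the join inequality with its constant,
`(1/(216√2))·√N·q_N(ℍ)² ≤ q_{2N+6}(ℍ) + q_{2N+8}(ℍ)` for `N ≥ 3` (`HexSAWPolygonJoinAssembly.pair_joinIneq_of_injOn` with the `24` piece labels and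
`Assembly.junctionUnique`); (ii) the prefactor-free envelope `q_N(ℍ) ≤ √(2+√2)^{N+2}` (`HexSAWPolygonSupermult.hexPolygonNumber_le_sqrt_pow`,
supermultiplicativity with multiplicity one) and `q_N ≤ q_{N+4}`; (iii) Madras' doubling lemma with constant ONE
(`Literature.Analysis.Asymptotics.Madras1995_doubling_polynomial`: `(√M a_M)² ≤ √(2M) a_{2M}`, `a_M^{1/M} → μ²` ⟹ `a_M ≤ M^{−1/2} μ^{2M}`).

## Contents (namespace `Literature.Probability.RandomPlanarGeometry.SAW.HexBW`; all `theorem`s, no `def`, no named-fact hypothesis)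
* `hexPolygonNumber_eq_zero_of_le_two` — `q_1(ℍ) = q_2(ℍ) = 0`;
* `Assembly.lbl_lt_twentyFour` — the piece label of the join assembly is `< 24` (the tree's `lbl_lt` is private; re-proved);
* **`hexPolygonNumber_joinIneq_explicit`** — `(1/(216√2))·√N·q_N(ℍ)² ≤ q_{2N+6}(ℍ) + q_{2N+8}(ℍ)`, `N ≥ 3`;
* **`rpow_bound_of_joinIneq_explicit`** — the abstract doubling bootstrap of `HexSAWPolygonMadrasBootstrapPair` with the EXPLICIT constant
  `A = √2·μ^K/c + B₀·√(2(N₀+K+m₀+26))` under the extra a-priori hypothesis `f(n) ≤ B₀ μ^n` (`n ≥ 1`) — same proof, the small lengths bounded by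
  the envelope instead of by a sum of values of `f`;
* **`hexPolygonNumber_le_explicit`** — `∀ N ≥ 1, q_N(ℍ) ≤ (1728·(2+√2)⁵ + (8+5√2)·√104) · N^{−1/2} · √(2+√2)^N`
  (pair trick `f(n) = q_n + q_{n+2}`: `(c/4)·√N·f(N)² ≤ f(2N+10)`, `K = 10`, `N₀ = 3`, `m₀ = 13`, `B₀ = μ² + μ⁴ = 8 + 5√2`);
* **`hexPolygonNumber_le_million`** — the round form `∀ N ≥ 1, q_N(ℍ) ≤ 10⁶ · N^{−1/2} · √(2+√2)^N` (`1728·(2+√2)⁵ + (8+5√2)·√104 ≈ 8.02·10⁵`).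

Sources.  N. Madras, *A rigorous bound on the critical exponent for the number of lattice trees, animals, and polygons*, J. Stat. Phys.
78 (1995) 681–699 [Madras1995LatticeAnimalsExponent], §2 (`p_n ≤ A n^{−1/2} μ^n` on `ℤ²`; primary source not held by the lane — reported by
A. Hammond, arXiv:1504.05286v5 [Hammond2015SAPJoining], §2 p. 4: "he has shown in [Madras95] using a polygon joining technique that
`θ_n ≥ 1/2 − o(1)` for `d = 2`"); H. Duminil-Copin, S. Smirnov, Ann. of Math. 175 (2012) [DuminilCopinSmirnov2012], Theorem 1 (`μ(ℍ) = √(2+√2)`);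
N. Madras, G. Slade, *The Self-Avoiding Walk* (1993) [MadrasSlade1993], Theorem 3.2.3 pp. 64–65 ((3.2.2)–(3.2.5): concatenation and the envelope
`q_N ≤ (d−1) μ^N` on `ℤ^d`).  Status in print (lane literature cells, LINE «HEX-MADRAS»): a honeycomb edition of Madras' bound, let alone one with
an explicit constant, is not located in print; what is NEW IN WRITING here is only the bookkeeping of the constant (modest) — the mathematics is
Madras' (1995).  The constant `10⁶` is far from optimal (the envelope `q_N ≤ μ^{N+2}` is better for `N < 5·10¹⁰`); no attempt is made to improve it.
-/

noncomputable section

open Filter Topology Finset Literature.Probability.LatticeModels Literature.Analysis.Asymptotics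

namespace Literature.Probability.RandomPlanarGeometry.SAW

namespace HexBW

/-! ### No honeycomb polygons with one or two bonds -/

/-- `q_1(ℍ) = q_2(ℍ) = 0`: there is no self-avoiding polygon with one bond (a bond is not a loop) or two bonds (the canonical orientation
`ω(1) ≺ ω(N−1)` is irreflexive at `N = 2`). [cite: MadrasSlade1993, Definition 3.2.2, p. 63 (q_N counts the N-step self-avoiding polygons; a polygon has at least 3 bonds)] -/
theorem hexPolygonNumber_eq_zero_of_le_two {N : ℕ} (hN1 : 1 ≤ N) (hN2 : N ≤ 2) : hexPolygonNumber N = 0 := by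
  classical
  rw [hexPolygonNumber, Finset.card_eq_zero, Finset.filter_eq_empty_iff]
  intro P hP _
  rw [Zd.PolygonConcat.polygonReps, Finset.mem_filter] at hP
  obtain ⟨hPc, hlt⟩ := hP
  interval_cases N
  · -- `N = 1`: `ω 0 = 0 = ω 1` would be adjacent to itself
    rw [Zd.PolygonConcat.canonLoops, Finset.mem_filter] at hPc
    obtain ⟨hsa, -⟩ := hPc
    rw [Zd.mem_saLoops] at hsa
    obtain ⟨hnn, h1, -⟩ := hsa
    rw [Zd.nnWalks, Finset.mem_filter] at hnn
    obtain ⟨-, h0, hadj⟩ := hnn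
    have h := hadj 0 (by norm_num)
    rw [zero_add, h0, h1] at h
    exact h.ne rfl
  · -- `N = 2`: `ω 1 ≺ ω 1` is false
    exact absurd hlt (lt_irrefl _)

/-! ### The explicit join inequality on `ℍ` -/

/-- The piece label is `< 24` (re-proved: the tree's `lbl_lt` is private). [cite: Hammond2015SAPJoining, §4.1 pp. 17–20 (arXiv v5)] -/
theorem Assembly.lbl_lt_twentyFour {N : ℕ} {x : Assembly.Dom} (hN : 3 ≤ N) (hx : x ∈ joinDomain (N - 1)) :
    Assembly.lbl N x < 24 := by
  have h := Assembly.jtype_mem (Assembly.isPolygon_Pof hN hx).1 (Assembly.isPolygon_Qof hN hx).1 (Assembly.corridor hN hx)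
    (Assembly.touch hN hx)
  unfold Assembly.lbl
  split_ifs <;> omega

/-- **The join inequality on `ℍ` with an explicit constant**: `(1/(216√2))·√N·q_N(ℍ)² ≤ q_{2N+6}(ℍ) + q_{2N+8}(ℍ)` for every `N ≥ 3`
(the pair form: the capless junctions add `K ∈ {2,4,6,8}` bonds; `24` piece labels, each piece injective by junction uniqueness).
[cite: Madras1995LatticeAnimalsExponent, §2 (p_{2n+K} ≥ c n^{1/2} p_n²)] [cite: Hammond2015SAPJoining, §3.4 eq. (3.6) and §4 (arXiv v5)] -/
theorem hexPolygonNumber_joinIneq_explicit {N : ℕ} (hN : 3 ≤ N) :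
    1 / (216 * Real.sqrt 2) * Real.sqrt N * (hexPolygonNumber N : ℝ) ^ 2 ≤
      hexPolygonNumber (2 * N + 6) + hexPolygonNumber (2 * N + 8) := by
  have h := Assembly.pair_joinIneq_of_injOn hN (by norm_num : 0 < 24) (Assembly.lbl N)
    (fun x hx => Assembly.lbl_lt_twentyFour hN hx) (fun K l => Assembly.injOn_of_junctionUnique Assembly.junctionUnique hN K l)
  have h72 : (3 * Real.sqrt 2 * (3 * (24 : ℕ)) : ℝ) = 216 * Real.sqrt 2 := by push_cast; ring
  rw [h72] at h
  exact h


/-! ### Madras' doubling bootstrap with an explicit constant -/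

/-- **Madras' doubling bootstrap, abstract form, EXPLICIT constant.**  Let `f : ℕ → ℝ` be non-negative, vanish on the odd integers `≥ 3`,
be positive on the even integers `≥ 2m₀`, with `log f(2n)/(2n) → log μ` (`μ ≥ 1`), satisfy the join inequality
`c·√N·f(N)² ≤ f(2N + K)` for the even `N ≥ N₀` (`c > 0`, `K` even) AND the a-priori bound `f(n) ≤ B₀·μ^n` (`n ≥ 1`).  Then
`f(N) ≤ A · N^{−1/2} · μ^N` for all `N ≥ 1` with the explicit constant `A = √2·μ^K/c + B₀·√(2(N₀ + K + m₀ + 26))`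
(the first summand from Madras' doubling `a_M ≤ M^{−1/2} μ^{2M}` for `a_M = c·f(2M − K)` above the threshold `M₁ = N₀ + K + m₀ + 26`, the
second from the a-priori bound below `2M₁`).  Same proof as the tree's `rpow_bound_of_joinIneq_abstract` (which concludes `∃ A`), with the
small-`N` range bounded by `B₀ μ^N` instead of a sum of values of `f`.
[cite: Madras1995LatticeAnimalsExponent, §2 (primary, not held: the a-priori bound from the superadditivity-type inequality)]
[cite: Hammond2015SAPJoining, §2 (arXiv v5 p. 4)] -/
theorem rpow_bound_of_joinIneq_explicit {f : ℕ → ℝ} {μ c B₀ : ℝ} {K N₀ m₀ : ℕ} (hμ1 : 1 ≤ μ) (hc : 0 < c) (hK : Even K)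
    (hf0 : ∀ n, 0 ≤ f n) (hfodd : ∀ n, 3 ≤ n → Odd n → f n = 0) (hfpos : ∀ m, m₀ ≤ m → 0 < f (2 * m))
    (hflim : Tendsto (fun n : ℕ => Real.log (f (2 * n)) / ((2 * n : ℕ) : ℝ)) atTop (𝓝 (Real.log μ)))
    (hJ : ∀ N : ℕ, N₀ ≤ N → Even N → c * Real.sqrt N * f N ^ 2 ≤ f (2 * N + K))
    (hB₀ : 0 ≤ B₀) (hfB : ∀ n, 1 ≤ n → f n ≤ B₀ * μ ^ n) :
    ∀ N : ℕ, 1 ≤ N → f N ≤ (Real.sqrt 2 * μ ^ K / c + B₀ * Real.sqrt ((2 * (N₀ + K + m₀ + 26) : ℕ) : ℝ)) *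
      (N : ℝ) ^ (-(1 / 2 : ℝ)) * μ ^ N := by
  obtain ⟨k, hk⟩ := hK
  have hμ0 : 0 < μ := lt_of_lt_of_le one_pos hμ1
  set q : ℕ → ℝ := f with hqdef
  have hq0 : ∀ N, 0 ≤ q N := hf0
  -- the threshold
  set M₁ : ℕ := N₀ + 2 * k + m₀ + 26 with hM₁
  -- the auxiliary sequence `a_M = c · q_{2(M−k)}`
  set a : ℕ → ℝ := fun M => if M₁ ≤ M then c * q (2 * (M - k)) else 0 with hadef
  have ha0 : ∀ n, 1 ≤ n → 0 ≤ a n := fun n _ => by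
    simp only [hadef]; split_ifs
    · exact mul_nonneg hc.le (hq0 _)
    · exact le_rfl
  have ha_of_ge : ∀ M, M₁ ≤ M → a M = c * q (2 * (M - k)) := fun M hM => by simp only [hadef]; rw [if_pos hM]
  have hqpos_even : ∀ M, M₁ ≤ M → 0 < q (2 * (M - k)) := fun M hM => hfpos (M - k) (by omega)
  -- (hsq): `(√M a_M)² ≤ √(2M) a_{2M}`
  have hsq : ∀ M : ℕ, 1 ≤ M → (((M : ℝ) ^ (1 / 2 : ℝ)) * a M) ^ 2 ≤ ((2 * M : ℕ) : ℝ) ^ (1 / 2 : ℝ) * a (2 * M) := by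
    intro M hM1
    by_cases hM : M₁ ≤ M
    · have h2M : M₁ ≤ 2 * M := by omega
      rw [ha_of_ge M hM, ha_of_ge (2 * M) h2M, ← Real.sqrt_eq_rpow, ← Real.sqrt_eq_rpow]
      -- the join inequality at `n = 2(M−k)`
      have hn₀ : N₀ ≤ 2 * (M - k) := by omega
      have hJ' := hJ (2 * (M - k)) hn₀ ⟨M - k, by ring⟩
      rw [show 2 * (2 * (M - k)) + K = 2 * (2 * M - k) by omega] at hJ'
      have hnpos : (0 : ℝ) < ((2 * (M - k) : ℕ) : ℝ) := by exact_mod_cast (show 0 < 2 * (M - k) by omega)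
      have hsqrtn : 0 < Real.sqrt ((2 * (M - k) : ℕ) : ℝ) := Real.sqrt_pos.2 hnpos
      -- `q_n² ≤ q_{2(2M−k)} / (c √n)`
      have hq2 : q (2 * (M - k)) ^ 2 ≤ q (2 * (2 * M - k)) / (c * Real.sqrt ((2 * (M - k) : ℕ) : ℝ)) := by
        rw [le_div_iff₀ (by positivity)]
        calc q (2 * (M - k)) ^ 2 * (c * Real.sqrt ((2 * (M - k) : ℕ) : ℝ))
            = c * Real.sqrt ((2 * (M - k) : ℕ) : ℝ) * q (2 * (M - k)) ^ 2 := by ring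
          _ ≤ q (2 * (2 * M - k)) := hJ'
      -- `M ≤ √(2M) √n` since `M² ≤ 2M · 2(M−k)` iff `4k ≤ 3M`
      have hgeo : (M : ℝ) ≤ Real.sqrt ((2 * M : ℕ) : ℝ) * Real.sqrt ((2 * (M - k) : ℕ) : ℝ) := by
        rw [← Real.sqrt_mul (by positivity)]
        apply Real.le_sqrt_of_sq_le
        have h1 : ((M : ℕ) : ℝ) ≤ 2 * ((2 * (M - k) : ℕ) : ℝ) := by
          have : M ≤ 2 * (2 * (M - k)) := by omega
          exact_mod_cast this
        have hM0 : (0 : ℝ) ≤ M := Nat.cast_nonneg _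
        calc ((M : ℝ)) ^ 2 = (M : ℝ) * M := sq _
          _ ≤ (M : ℝ) * (2 * ((2 * (M - k) : ℕ) : ℝ)) := mul_le_mul_of_nonneg_left h1 hM0
          _ = ((2 * M : ℕ) : ℝ) * ((2 * (M - k) : ℕ) : ℝ) := by push_cast; ring
      calc (Real.sqrt (M : ℝ) * (c * q (2 * (M - k)))) ^ 2 = (M : ℝ) * c ^ 2 * q (2 * (M - k)) ^ 2 := by
            rw [mul_pow, Real.sq_sqrt (Nat.cast_nonneg _)]; ring
        _ ≤ (M : ℝ) * c ^ 2 * (q (2 * (2 * M - k)) / (c * Real.sqrt ((2 * (M - k) : ℕ) : ℝ))) :=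
            mul_le_mul_of_nonneg_left hq2 (by positivity)
        _ = (M : ℝ) / Real.sqrt ((2 * (M - k) : ℕ) : ℝ) * (c * q (2 * (2 * M - k))) := by
            field_simp
        _ ≤ Real.sqrt ((2 * M : ℕ) : ℝ) * (c * q (2 * (2 * M - k))) := by
            apply mul_le_mul_of_nonneg_right _ (mul_nonneg hc.le (hq0 _))
            rw [div_le_iff₀ hsqrtn]; exact hgeo
    · -- below the threshold `a_M = 0`
      have : a M = 0 := by simp only [hadef]; rw [if_neg hM]
      rw [this, mul_zero, zero_pow two_ne_zero]
      exact mul_nonneg (Real.rpow_nonneg (Nat.cast_nonneg _) _) (ha0 _ (by omega))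
  -- (hlim): `a_n^{1/n} → μ²`
  have hKlim : Tendsto (fun n : ℕ => n - k) atTop atTop := tendsto_sub_atTop_nat k
  have hlog : Tendsto (fun n : ℕ => Real.log (a n) / n) atTop (𝓝 (Real.log (μ ^ 2))) := by
    -- `log a_n / n = log c / n + (log q_{2(n−k)} / (2(n−k))) · (2(n−k)/n)`
    have h1 : Tendsto (fun n : ℕ => Real.log c / n) atTop (𝓝 0) :=
      tendsto_const_nhds.div_atTop tendsto_natCast_atTop_atTop
    have h2 : Tendsto (fun n : ℕ => Real.log (q (2 * (n - k))) / ((2 * (n - k) : ℕ) : ℝ)) atTop (𝓝 (Real.log μ)) :=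
      hflim.comp hKlim
    have h3 : Tendsto (fun n : ℕ => (((2 * (n - k) : ℕ) : ℝ)) / n) atTop (𝓝 2) := by
      have h31 : Tendsto (fun n : ℕ => (2 : ℝ) - (2 * k : ℝ) / n) atTop (𝓝 (2 - 0)) :=
        tendsto_const_nhds.sub (tendsto_const_nhds.div_atTop tendsto_natCast_atTop_atTop)
      rw [sub_zero] at h31
      refine h31.congr' ?_
      filter_upwards [eventually_ge_atTop (k + 1)] with n hn
      have hn0 : (n : ℝ) ≠ 0 := by exact_mod_cast (show n ≠ 0 by omega)
      rw [Nat.cast_mul, Nat.cast_sub (by omega)]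
      push_cast
      field_simp
    have h4 := h1.add (h2.mul h3)
    rw [zero_add, show Real.log μ * 2 = Real.log (μ ^ 2) by rw [Real.log_pow]; push_cast; ring] at h4
    refine h4.congr' ?_
    filter_upwards [eventually_ge_atTop (M₁ + 1)] with n hn
    have hqpos : 0 < q (2 * (n - k)) := hqpos_even n (by omega)
    have hn0 : (n : ℝ) ≠ 0 := by exact_mod_cast (show n ≠ 0 by omega)
    have hnK0 : ((2 * (n - k) : ℕ) : ℝ) ≠ 0 := by exact_mod_cast (show 2 * (n - k) ≠ 0 by omega)
    rw [ha_of_ge n (by omega), Real.log_mul hc.ne' hqpos.ne']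
    field_simp
  have hlim : Tendsto (fun n : ℕ => a n ^ (1 / (n : ℝ))) atTop (𝓝 (μ ^ 2)) := by
    have hexp := (Real.continuous_exp.tendsto _).comp hlog
    rw [Real.exp_log (by positivity : (0 : ℝ) < μ ^ 2)] at hexp
    refine hexp.congr' ?_
    filter_upwards [eventually_ge_atTop (M₁ + 1)] with n hn
    have hqpos : 0 < q (2 * (n - k)) := hqpos_even n (by omega)
    have hapos : 0 < a n := by rw [ha_of_ge n (by omega)]; exact mul_pos hc hqpos
    simp only [Function.comp]
    rw [Real.rpow_def_of_pos hapos, one_div, ← div_eq_mul_inv]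
  -- apply the doubling lemma with `θ = 1/2`, `λ = μ²`
  have hmain : ∀ N : ℕ, 1 ≤ N → a N ≤ (N : ℝ) ^ (-(1 / 2 : ℝ)) * (μ ^ 2) ^ N :=
    fun N hN => Madras1995_doubling_polynomial ha0 hsq hlim hN
  -- constants (explicit)
  set N₁ : ℕ := 2 * M₁ with hN₁
  have hKk : K = 2 * k := by omega
  have hN₁' : (2 * (N₀ + K + m₀ + 26) : ℕ) = N₁ := by rw [hN₁, hM₁]; omega
  rw [hN₁']
  set B : ℝ := B₀ * Real.sqrt (N₁ : ℝ) with hB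
  have hB0 : 0 ≤ B := mul_nonneg hB₀ (Real.sqrt_nonneg _)
  intro N hN
  rw [hKk]
  have hN0 : (0 : ℝ) < N := by exact_mod_cast (show 0 < N by omega)
  have hrpow : (N : ℝ) ^ (-(1 / 2 : ℝ)) = 1 / Real.sqrt N := by
    rw [Real.rpow_neg hN0.le, ← Real.sqrt_eq_rpow, one_div]
  have hsqrtN : 0 < Real.sqrt N := Real.sqrt_pos.2 hN0
  have hA10 : 0 ≤ Real.sqrt 2 * μ ^ (2 * k) / c := by positivity
  have hfac0 : 0 ≤ (N : ℝ) ^ (-(1 / 2 : ℝ)) * μ ^ N := by positivity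
  by_cases hbig : N₁ ≤ N
  · rcases Nat.even_or_odd N with ⟨m, hm⟩ | hodd
    · -- even `N = 2m`, `M := m + k ≥ M₁`: `c q_N = a_M ≤ M^{-1/2} μ^{2M} ≤ √2 N^{-1/2} μ^{2k} μ^N`
      have hMge : M₁ ≤ m + k := by omega
      have h1 := hmain (m + k) (by omega)
      rw [ha_of_ge (m + k) hMge, show 2 * (m + k - k) = N by omega] at h1
      have hm0 : (0 : ℝ) < ((m + k : ℕ) : ℝ) := by exact_mod_cast (show 0 < m + k by omega)
      have hm0' : (0 : ℝ) < (m : ℝ) := by exact_mod_cast (show 0 < m by omega)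
      -- `(m+k)^{-1/2} ≤ m^{-1/2} = √2 · N^{-1/2}`
      have hmono : ((m + k : ℕ) : ℝ) ^ (-(1 / 2 : ℝ)) ≤ Real.sqrt 2 * (N : ℝ) ^ (-(1 / 2 : ℝ)) := by
        rw [Real.rpow_neg hm0.le, Real.rpow_neg hN0.le, ← Real.sqrt_eq_rpow, ← Real.sqrt_eq_rpow]
        have hNm : (N : ℝ) = 2 * m := by rw [hm]; push_cast; ring
        have hs : Real.sqrt (N : ℝ) = Real.sqrt 2 * Real.sqrt m := by
          rw [hNm, Real.sqrt_mul (by norm_num : (0 : ℝ) ≤ 2)]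
        have h2pos : 0 < Real.sqrt 2 := Real.sqrt_pos.2 (by norm_num)
        rw [hs, mul_inv, ← mul_assoc, mul_inv_cancel₀ h2pos.ne', one_mul]
        exact inv_anti₀ (Real.sqrt_pos.2 hm0') (Real.sqrt_le_sqrt (by exact_mod_cast (show m ≤ m + k by omega)))
      have hpow : (μ ^ 2) ^ (m + k) = μ ^ (2 * k) * μ ^ N := by
        rw [← pow_mul, show 2 * (m + k) = 2 * k + N by omega, pow_add]
      have h2 : c * q N ≤ Real.sqrt 2 * (N : ℝ) ^ (-(1 / 2 : ℝ)) * (μ ^ (2 * k) * μ ^ N) := by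
        calc c * q N ≤ ((m + k : ℕ) : ℝ) ^ (-(1 / 2 : ℝ)) * (μ ^ 2) ^ (m + k) := h1
          _ ≤ Real.sqrt 2 * (N : ℝ) ^ (-(1 / 2 : ℝ)) * (μ ^ 2) ^ (m + k) :=
              mul_le_mul_of_nonneg_right hmono (by positivity)
          _ = Real.sqrt 2 * (N : ℝ) ^ (-(1 / 2 : ℝ)) * (μ ^ (2 * k) * μ ^ N) := by rw [hpow]
      have h3 : q N ≤ Real.sqrt 2 * μ ^ (2 * k) / c * (N : ℝ) ^ (-(1 / 2 : ℝ)) * μ ^ N := by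
        rw [div_mul_eq_mul_div, div_mul_eq_mul_div, le_div_iff₀ hc]
        calc q N * c = c * q N := mul_comm _ _
          _ ≤ Real.sqrt 2 * (N : ℝ) ^ (-(1 / 2 : ℝ)) * (μ ^ (2 * k) * μ ^ N) := h2
          _ = Real.sqrt 2 * μ ^ (2 * k) * (N : ℝ) ^ (-(1 / 2 : ℝ)) * μ ^ N := by ring
      calc q N ≤ Real.sqrt 2 * μ ^ (2 * k) / c * (N : ℝ) ^ (-(1 / 2 : ℝ)) * μ ^ N := h3
        _ ≤ (Real.sqrt 2 * μ ^ (2 * k) / c + B) * (N : ℝ) ^ (-(1 / 2 : ℝ)) * μ ^ N := by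
            nlinarith [mul_nonneg hB0 hfac0]
    · -- odd `N ≥ 3`: `q_N = 0`
      have hz : q N = 0 := hfodd N (by omega) hodd
      rw [hz]
      exact mul_nonneg (mul_nonneg (add_nonneg hA10 hB0) (by positivity)) (by positivity)
  · -- small `N < N₁`: `q_N ≤ B₀ μ^N ≤ B₀ √N₁ · N^{-1/2} μ^N`
    have hNlt : N < N₁ := by omega
    have hle1 : (1 : ℝ) ≤ Real.sqrt (N₁ : ℝ) * (N : ℝ) ^ (-(1 / 2 : ℝ)) := by
      rw [hrpow, mul_one_div, le_div_iff₀ hsqrtN, one_mul]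
      exact Real.sqrt_le_sqrt (by exact_mod_cast hNlt.le)
    have hμN : 0 ≤ μ ^ N := by positivity
    have hstep : q N ≤ B * (N : ℝ) ^ (-(1 / 2 : ℝ)) * μ ^ N := by
      calc q N ≤ B₀ * μ ^ N := hfB N hN
        _ = B₀ * 1 * μ ^ N := by rw [mul_one]
        _ ≤ B₀ * (Real.sqrt (N₁ : ℝ) * (N : ℝ) ^ (-(1 / 2 : ℝ))) * μ ^ N :=
            mul_le_mul_of_nonneg_right (mul_le_mul_of_nonneg_left hle1 hB₀) hμN
        _ = B * (N : ℝ) ^ (-(1 / 2 : ℝ)) * μ ^ N := by rw [hB]; ring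
    calc q N ≤ B * (N : ℝ) ^ (-(1 / 2 : ℝ)) * μ ^ N := hstep
      _ ≤ (Real.sqrt 2 * μ ^ (2 * k) / c + B) * (N : ℝ) ^ (-(1 / 2 : ℝ)) * μ ^ N := by
          nlinarith [mul_nonneg hA10 hfac0]


/-! ### The explicit constant on `ℍ` -/

/-- **Madras' bound on the honeycomb lattice with an explicit constant**: for every `N ≥ 1`,
`q_N(ℍ) ≤ (1728·(2+√2)⁵ + (8+5√2)·√104) · N^{−1/2} · √(2+√2)^N`.
Route: the explicit join inequality `(1/(216√2))·√N·q_N² ≤ q_{2N+6} + q_{2N+8}` (`N ≥ 3`), the pair trick `f(n) := q_n + q_{n+2}`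
(`(c/4)·√N·f(N)² ≤ f(2N+10)` by `q_m ≤ q_{m+4}`), the a-priori envelope `q_n ≤ μ_ℍ^{n+2}` (so `f(n) ≤ (μ_ℍ² + μ_ℍ⁴)·μ_ℍ^n`, `q_1 = q_2 = 0`),
and the explicit doubling bootstrap `rpow_bound_of_joinIneq_explicit` (`K = 10`, `N₀ = 3`, `m₀ = 13`, `c/4 = 1/(864√2)`):
`A = √2·μ_ℍ^{10}·864√2 + (μ_ℍ²+μ_ℍ⁴)·√(2·52) = 1728·(2+√2)⁵ + (8+5√2)·√104` with `μ_ℍ = √(2+√2)` (Duminil-Copin–Smirnov).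
The `ℤ²` analogue with an explicit constant is the tree's `SAW.JoinParity.madras1995_polygonBound_explicit` (`A = 2μ¹⁶`).
[cite: Madras1995LatticeAnimalsExponent, §2 (θ ≥ 1/2 in two dimensions; primary, not held)] [cite: Hammond2015SAPJoining, §2 p. 4 and §4
(arXiv v5)] [cite: DuminilCopinSmirnov2012, Theorem 1 (μ(ℍ) = √(2+√2))] [cite: MadrasSlade1993, Theorem 3.2.3 pp. 64–65] -/
theorem hexPolygonNumber_le_explicit {N : ℕ} (hN : 1 ≤ N) :
    (hexPolygonNumber N : ℝ) ≤ (1728 * (2 + Real.sqrt 2) ^ 5 + (8 + 5 * Real.sqrt 2) * Real.sqrt 104) *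
      (N : ℝ) ^ (-(1 / 2 : ℝ)) * Real.sqrt (2 + Real.sqrt 2) ^ N := by
  have hμeq : hexConnectiveConstant = Real.sqrt (2 + Real.sqrt 2) :=
    hexConnectiveConstant_eq_of_thm1 DuminilCopinSmirnov2012_thm1_holds
  set μ : ℝ := Real.sqrt (2 + Real.sqrt 2) with hμdef
  have hμ1 : 1 ≤ μ := by rw [← hμeq]; exact one_le_hexConnectiveConstant
  have hμ0 : 0 ≤ μ := zero_le_one.trans hμ1
  have hμsq : μ ^ 2 = 2 + Real.sqrt 2 := by rw [hμdef, Real.sq_sqrt (by positivity)]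
  set q : ℕ → ℝ := fun N => (hexPolygonNumber N : ℝ) with hqdef
  have hq0 : ∀ N, 0 ≤ q N := fun N => Nat.cast_nonneg _
  set f : ℕ → ℝ := fun n => q n + q (n + 2) with hfdef
  have hf0 : ∀ n, 0 ≤ f n := fun n => add_nonneg (hq0 _) (hq0 _)
  have hfodd : ∀ n, 3 ≤ n → Odd n → f n = 0 := by
    intro n hn hodd
    have h1 : (hexPolygonNumber n : ℝ) = 0 := by exact_mod_cast hexPolygonNumber_eq_zero_of_odd (by omega) hodd
    have h2 : (hexPolygonNumber (n + 2) : ℝ) = 0 := by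
      exact_mod_cast hexPolygonNumber_eq_zero_of_odd (by omega) (by obtain ⟨j, hj⟩ := hodd; exact ⟨j + 1, by omega⟩)
    simp only [hfdef, hqdef, h1, h2, add_zero]
  have hfpos : ∀ m, 13 ≤ m → 0 < f (2 * m) := by
    intro m hm
    have : (0 : ℝ) < (hexPolygonNumber (2 * m) : ℝ) := by
      exact_mod_cast hexPolygonNumber_pos_of_even (by omega) ⟨m, by ring⟩
    exact add_pos_of_pos_of_nonneg this (hq0 _)
  have hflim : Tendsto (fun n : ℕ => Real.log (f (2 * n)) / ((2 * n : ℕ) : ℝ)) atTop (𝓝 (Real.log μ)) := by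
    rw [← hμeq]; exact tendsto_log_hexPolygonNumber_pair_div
  -- monotonicity `q_m ≤ q_{m+4}` (`m ≥ 3`) and the envelope `q_m ≤ μ^{m+2}` (`m ≥ 3`)
  have hmono : ∀ m : ℕ, 3 ≤ m → q m ≤ q (m + 4) := fun m hm => by
    show (hexPolygonNumber m : ℝ) ≤ (hexPolygonNumber (m + 4) : ℝ)
    exact_mod_cast hexPolygonNumber_le_add_four hm
  have henv : ∀ m : ℕ, 3 ≤ m → q m ≤ μ ^ (m + 2) := fun m hm => hexPolygonNumber_le_sqrt_pow hm
  -- the explicit join inequality, single-length form for `f`: `(c/4)·√N·f(N)² ≤ f(2N+10)`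
  set c : ℝ := 1 / (216 * Real.sqrt 2) with hcdef
  have hc : 0 < c := by positivity
  have hJ' : ∀ N : ℕ, 3 ≤ N → Even N → c / 4 * Real.sqrt N * f N ^ 2 ≤ f (2 * N + 10) := by
    intro N hN3 _
    have h1 : c * Real.sqrt N * q N ^ 2 ≤ q (2 * N + 6) + q (2 * N + 8) := hexPolygonNumber_joinIneq_explicit hN3
    have h2 : c * Real.sqrt ((N + 2 : ℕ) : ℝ) * q (N + 2) ^ 2 ≤ q (2 * N + 10) + q (2 * N + 12) := by
      have := hexPolygonNumber_joinIneq_explicit (N := N + 2) (by omega)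
      rw [show 2 * (N + 2) + 6 = 2 * N + 10 by ring, show 2 * (N + 2) + 8 = 2 * N + 12 by ring] at this
      exact this
    have hsqrt : Real.sqrt (N : ℝ) ≤ Real.sqrt ((N + 2 : ℕ) : ℝ) :=
      Real.sqrt_le_sqrt (by exact_mod_cast (show N ≤ N + 2 by omega))
    have hsN : 0 ≤ Real.sqrt (N : ℝ) := Real.sqrt_nonneg _
    have h2' : c * Real.sqrt N * q (N + 2) ^ 2 ≤ q (2 * N + 10) + q (2 * N + 12) :=
      le_trans (mul_le_mul_of_nonneg_right (mul_le_mul_of_nonneg_left hsqrt hc.le) (sq_nonneg _)) h2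
    have hm1 : q (2 * N + 6) ≤ q (2 * N + 10) := by
      have := hmono (2 * N + 6) (by omega); rw [show 2 * N + 6 + 4 = 2 * N + 10 by ring] at this; exact this
    have hm2 : q (2 * N + 8) ≤ q (2 * N + 12) := by
      have := hmono (2 * N + 8) (by omega); rw [show 2 * N + 8 + 4 = 2 * N + 12 by ring] at this; exact this
    have hsq : f N ^ 2 ≤ 2 * q N ^ 2 + 2 * q (N + 2) ^ 2 := by
      simp only [hfdef]; nlinarith [sq_nonneg (q N - q (N + 2))]
    have hfout : f (2 * N + 10) = q (2 * N + 10) + q (2 * N + 12) := by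
      simp only [hfdef]
    rw [hfout]
    have hcs : 0 ≤ c * Real.sqrt N := mul_nonneg hc.le hsN
    calc c / 4 * Real.sqrt N * f N ^ 2 = (c * Real.sqrt N * f N ^ 2) / 4 := by ring
      _ ≤ (c * Real.sqrt N * (2 * q N ^ 2 + 2 * q (N + 2) ^ 2)) / 4 := by
          apply div_le_div_of_nonneg_right (mul_le_mul_of_nonneg_left hsq hcs) (by norm_num)
      _ = (c * Real.sqrt N * q N ^ 2 + c * Real.sqrt N * q (N + 2) ^ 2) / 2 := by ring
      _ ≤ ((q (2 * N + 6) + q (2 * N + 8)) + (q (2 * N + 10) + q (2 * N + 12))) / 2 := by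
          apply div_le_div_of_nonneg_right (add_le_add h1 h2') (by norm_num)
      _ ≤ ((q (2 * N + 10) + q (2 * N + 12)) + (q (2 * N + 10) + q (2 * N + 12))) / 2 := by
          apply div_le_div_of_nonneg_right _ (by norm_num); linarith
      _ = q (2 * N + 10) + q (2 * N + 12) := by ring
  -- the a-priori bound `f(n) ≤ (μ² + μ⁴)·μ^n` (`n ≥ 1`)
  have hB₀ : (0 : ℝ) ≤ μ ^ 2 + μ ^ 4 := by positivity
  have hfB : ∀ n, 1 ≤ n → f n ≤ (μ ^ 2 + μ ^ 4) * μ ^ n := by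
    intro n hn
    have hq2 : q (n + 2) ≤ μ ^ 4 * μ ^ n := by
      have := henv (n + 2) (by omega)
      rw [show n + 2 + 2 = 4 + n by ring, pow_add] at this; exact this
    have hq1 : q n ≤ μ ^ 2 * μ ^ n := by
      by_cases h3 : 3 ≤ n
      · have := henv n h3; rw [show n + 2 = 2 + n by ring, pow_add] at this; exact this
      · have hz : q n = 0 := by
          show (hexPolygonNumber n : ℝ) = 0
          exact_mod_cast hexPolygonNumber_eq_zero_of_le_two hn (by omega)
        rw [hz]; positivity
    calc f n = q n + q (n + 2) := rfl
      _ ≤ μ ^ 2 * μ ^ n + μ ^ 4 * μ ^ n := add_le_add hq1 hq2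
      _ = (μ ^ 2 + μ ^ 4) * μ ^ n := by ring
  -- the explicit bootstrap
  have hmain := rpow_bound_of_joinIneq_explicit (f := f) (K := 10) (N₀ := 3) (m₀ := 13) hμ1 (by positivity : 0 < c / 4)
    ⟨5, by norm_num⟩ hf0 hfodd hfpos hflim hJ' hB₀ hfB N hN
  -- the constant: `√2·μ^10/(c/4) + (μ²+μ⁴)·√(2·52) = 1728·(2+√2)^5 + (8+5√2)·√104`
  have hs2 : (0 : ℝ) < Real.sqrt 2 := Real.sqrt_pos.2 (by norm_num)
  have hs2sq : Real.sqrt 2 ^ 2 = 2 := Real.sq_sqrt (by norm_num)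
  have hμ10 : μ ^ 10 = (2 + Real.sqrt 2) ^ 5 := by rw [show (10 : ℕ) = 2 * 5 by norm_num, pow_mul, hμsq]
  have hμ24 : μ ^ 2 + μ ^ 4 = 8 + 5 * Real.sqrt 2 := by
    rw [show μ ^ 4 = (μ ^ 2) ^ 2 by ring, hμsq]; nlinarith [hs2sq]
  have hconst : Real.sqrt 2 * μ ^ 10 / (c / 4) + (μ ^ 2 + μ ^ 4) * Real.sqrt ((2 * (3 + 10 + 13 + 26) : ℕ) : ℝ) =
      1728 * (2 + Real.sqrt 2) ^ 5 + (8 + 5 * Real.sqrt 2) * Real.sqrt 104 := by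
    rw [hμ10, hμ24, hcdef]
    have : Real.sqrt 2 * (2 + Real.sqrt 2) ^ 5 / (1 / (216 * Real.sqrt 2) / 4) = 1728 * (2 + Real.sqrt 2) ^ 5 := by
      field_simp
      nlinarith [hs2sq]
    rw [this]
    norm_num
  calc (hexPolygonNumber N : ℝ) = q N := rfl
    _ ≤ f N := le_add_of_nonneg_right (hq0 _)
    _ ≤ _ := hmain
    _ = _ := by rw [hconst]

/-- **Round form**: `q_N(ℍ) ≤ 10⁶ · N^{−1/2} · √(2+√2)^N` for every `N ≥ 1` (`1728·(2+√2)⁵ + (8+5√2)·√104 < 8.1·10⁵`).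
[cite: Madras1995LatticeAnimalsExponent, §2] [cite: DuminilCopinSmirnov2012, Theorem 1] -/
theorem hexPolygonNumber_le_million {N : ℕ} (hN : 1 ≤ N) :
    (hexPolygonNumber N : ℝ) ≤ 1000000 * (N : ℝ) ^ (-(1 / 2 : ℝ)) * Real.sqrt (2 + Real.sqrt 2) ^ N := by
  have h := hexPolygonNumber_le_explicit hN
  have hs2 : Real.sqrt 2 < 1.415 := by
    rw [Real.sqrt_lt' (by norm_num)]; norm_num
  have hs2' : 0 ≤ Real.sqrt 2 := Real.sqrt_nonneg _
  have hs104 : Real.sqrt 104 < 10.2 := by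
    rw [Real.sqrt_lt' (by norm_num)]; norm_num
  have hs104' : 0 ≤ Real.sqrt 104 := Real.sqrt_nonneg _
  have hA : 1728 * (2 + Real.sqrt 2) ^ 5 + (8 + 5 * Real.sqrt 2) * Real.sqrt 104 ≤ 1000000 := by
    have h1 : (2 + Real.sqrt 2) ^ 5 ≤ 3.415 ^ 5 := by
      exact pow_le_pow_left₀ (by positivity) (by linarith) 5
    nlinarith [mul_nonneg hs2' hs104']
  have hfac : 0 ≤ (N : ℝ) ^ (-(1 / 2 : ℝ)) * Real.sqrt (2 + Real.sqrt 2) ^ N := by positivity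
  calc (hexPolygonNumber N : ℝ) ≤ _ := h
    _ = (1728 * (2 + Real.sqrt 2) ^ 5 + (8 + 5 * Real.sqrt 2) * Real.sqrt 104) *
          ((N : ℝ) ^ (-(1 / 2 : ℝ)) * Real.sqrt (2 + Real.sqrt 2) ^ N) := by ring
    _ ≤ 1000000 * ((N : ℝ) ^ (-(1 / 2 : ℝ)) * Real.sqrt (2 + Real.sqrt 2) ^ N) := mul_le_mul_of_nonneg_right hA hfac
    _ = _ := by ring

end HexBW

end Literature.Probability.RandomPlanarGeometry.SAW

end
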